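import Summits.AtomisticToContinuum.BoseEinsteinCondensation.Theorems.BECConjugateDominationPositiveMinimiserRegularity
import Literature.MathematicalPhysics.QuantumManyBody.PeriodicHeatFlowSpectral
import Literature.MathematicalPhysics.QuantumManyBody.PeriodicGroundStateFeynmanKacProofs
import Mathlib.Analysis.SpecialFunctions.ExpDeriv
import Mathlib.MeasureTheory.Integral.Prod
import HarnessLib

/-!
# Crux `HardCoreExtension`, line `third-law-current-floor` — `stub_forwardDuhamelOfMild`:
# the forward Duhamel identity of the periodic Feynman–Kac ground state from the mild identity

For a measurable pair potential `v` with BOUNDED periodisation `v^per ≤ C` (so the real interaction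
`W = (∑_{i<j} v^per(xᵢ - xⱼ)).toReal` is bounded and measurable, not continuous) and the
Feynman–Kac ground state `Ψ₀` of `H = -Δ + W` on the torus (`IsPeriodicGroundStateFK v L Ψ₀`,
eigenvalue `λ = E₀`), the MILD Duhamel identity of the periodic Feynman–Kac functional against the
free flow (hypothesis; `E[g(B_T)] = (e^{-TH}g)(X) + ∫_{(0,T]} E[W(B_s) (e^{-(T-s)H}g)(B_s)] ds`)
implies the FORWARD Duhamel identity

  `duhamel 1 ((W - λ)Ψ₀) X = ∫₀¹ P_s((W - λ)Ψ₀)(X) ds = P_1Ψ₀(X) - Ψ₀(X)`.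

Proof: test the mild identity on `g = Ψ₀ ≥ 0` and use the eigen-relation `e^{-tH}Ψ₀ = e^{-λt}Ψ₀`
in both Feynman–Kac terms; in real terms, with `F(T) = P_TΨ₀(X)` and `G(s) = P_s(WΨ₀)(X)`,
`F(T) = e^{-λT}Ψ₀(X) + ∫₀ᵀ e^{-λ(T-s)} G(s) ds` for every `T ≥ 0` (`ForwardDuhamel.heatOpR_eq_of_mild`).
One Fubini on the triangle `0 < u ≤ s ≤ 1` (`ForwardDuhamel.integral_Ioc_mul_integral_Ioc_swap`) and
the two elementary exponential integrals then give `∫₀¹ (G - λF) = F(1) - Ψ₀(X)`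
(`ForwardDuhamel.integral_sub_mul_eq_of_mild`), and `P_s((W - λ)Ψ₀) = G(s) - λF(s)` by linearity.
Continuity (hence boundedness) of `Ψ₀` comes from the proved fact `PeriodicGroundStateFeynmanKac_holds`
and uniqueness of the witness. All [folklore].
-/

noncomputable section

namespace Summit.AtomisticToContinuum.BoseEinsteinCondensation.Cruxes.HardCoreExtension.ThirdLawCurrentFloor

open MeasureTheory Filter Set intervalIntegral
open scoped ENNReal NNReal Topology
open Literature.MathematicalPhysics.QuantumManyBody.BoseGas
open Summit.AtomisticToContinuum.BoseEinsteinCondensation.Theorems.PositiveMinimiser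

namespace ForwardDuhamel

/-! ### Real analysis on `[0, 1]` -/

/-- `∫ₐᵇ λ e^{-λs} ds = e^{-λa} - e^{-λb}` (also for `λ = 0`). [folklore] -/
theorem integral_mul_exp_neg_mul (lam a b : ℝ) :
    ∫ s in a..b, lam * Real.exp (-(lam * s)) = Real.exp (-(lam * a)) - Real.exp (-(lam * b)) := by
  have hd : ∀ x ∈ uIcc a b,
      HasDerivAt (fun s : ℝ => -Real.exp (-(lam * s))) (lam * Real.exp (-(lam * x))) x := by
    intro x _
    have h1 : HasDerivAt (fun s : ℝ => -(lam * s)) (-lam) x := by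
      simpa only [id_eq, mul_one] using ((hasDerivAt_id x).const_mul lam).fun_neg
    exact h1.exp.fun_neg.congr_deriv (by ring)
  rw [integral_eq_sub_of_hasDerivAt hd
    ((by fun_prop : Continuous fun s : ℝ => lam * Real.exp (-(lam * s))).intervalIntegrable a b)]
  ring

/-- **Fubini on the triangle `0 < u ≤ s ≤ 1`**: for `φ` integrable on `(0, 1]` and continuous `g`,
`∫_{(0,1]} g(s) (∫_{(0,s]} φ) ds = ∫_{(0,1]} φ(u) (∫ᵤ¹ g) du`. [folklore] -/
theorem integral_Ioc_mul_integral_Ioc_swap {φ g : ℝ → ℝ} (hφ : IntegrableOn φ (Ioc 0 1))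
    (hg : Continuous g) :
    ∫ s in Ioc (0 : ℝ) 1, g s * ∫ u in Ioc 0 s, φ u =
      ∫ u in Ioc (0 : ℝ) 1, φ u * ∫ s in u..1, g s := by
  have hDm : MeasurableSet {p : ℝ × ℝ | p.2 ≤ p.1} := measurableSet_le measurable_snd measurable_fst
  have hgi : Integrable g (volume.restrict (Ioc (0 : ℝ) 1)) := hg.integrableOn_Ioc
  have hHi : Integrable (fun p : ℝ × ℝ => g p.1 * φ p.2)
      ((volume.restrict (Ioc (0 : ℝ) 1)).prod (volume.restrict (Ioc (0 : ℝ) 1))) :=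
    hgi.mul_prod hφ
  have hswap := integral_integral_swap (μ := volume.restrict (Ioc (0 : ℝ) 1))
    (ν := volume.restrict (Ioc (0 : ℝ) 1))
    (f := fun s u => ({p : ℝ × ℝ | p.2 ≤ p.1}.indicator (fun p : ℝ × ℝ => g p.1 * φ p.2) (s, u)))
    (hHi.indicator hDm)
  have hL : ∀ s ∈ Ioc (0 : ℝ) 1,
      ∫ u in Ioc (0 : ℝ) 1, {p : ℝ × ℝ | p.2 ≤ p.1}.indicator (fun p : ℝ × ℝ => g p.1 * φ p.2) (s, u) =
        g s * ∫ u in Ioc 0 s, φ u := by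
    intro s hs
    have h1 : (fun u => {p : ℝ × ℝ | p.2 ≤ p.1}.indicator (fun p : ℝ × ℝ => g p.1 * φ p.2) (s, u)) =
        (Iic s).indicator (fun u => g s * φ u) := by
      funext u
      simp only [Set.indicator_apply, Set.mem_setOf_eq, Set.mem_Iic]
    have h2 : Iic s ∩ Ioc (0 : ℝ) 1 = Ioc 0 s := by
      ext u
      simp only [mem_inter_iff, mem_Iic, mem_Ioc]
      exact ⟨fun h => ⟨h.2.1, h.1⟩, fun h => ⟨h.2, h.1, h.2.trans hs.2⟩⟩
    rw [h1, MeasureTheory.integral_indicator measurableSet_Iic,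
      Measure.restrict_restrict measurableSet_Iic, h2, MeasureTheory.integral_const_mul]
  have hR : ∀ u ∈ Ioc (0 : ℝ) 1,
      ∫ s in Ioc (0 : ℝ) 1, {p : ℝ × ℝ | p.2 ≤ p.1}.indicator (fun p : ℝ × ℝ => g p.1 * φ p.2) (s, u) =
        φ u * ∫ s in u..1, g s := by
    intro u hu
    have h1 : (fun s => {p : ℝ × ℝ | p.2 ≤ p.1}.indicator (fun p : ℝ × ℝ => g p.1 * φ p.2) (s, u)) =
        (Ici u).indicator (fun s => g s * φ u) := by
      funext s
      simp only [Set.indicator_apply, Set.mem_setOf_eq, Set.mem_Ici]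
    have h2 : Ici u ∩ Ioc (0 : ℝ) 1 = Icc u 1 := by
      ext s
      simp only [mem_inter_iff, mem_Ici, mem_Ioc, mem_Icc]
      exact ⟨fun h => ⟨h.1, h.2.2⟩, fun h => ⟨h.1, hu.1.trans_le h.1, h.2⟩⟩
    rw [h1, MeasureTheory.integral_indicator measurableSet_Ici,
      Measure.restrict_restrict measurableSet_Ici, h2, integral_Icc_eq_integral_Ioc,
      ← intervalIntegral.integral_of_le hu.2, intervalIntegral.integral_mul_const, mul_comm]
  calc ∫ s in Ioc (0 : ℝ) 1, g s * ∫ u in Ioc 0 s, φ u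
      = ∫ s in Ioc (0 : ℝ) 1, ∫ u in Ioc (0 : ℝ) 1,
          {p : ℝ × ℝ | p.2 ≤ p.1}.indicator (fun p : ℝ × ℝ => g p.1 * φ p.2) (s, u) :=
        (setIntegral_congr_fun measurableSet_Ioc hL).symm
    _ = ∫ u in Ioc (0 : ℝ) 1, ∫ s in Ioc (0 : ℝ) 1,
          {p : ℝ × ℝ | p.2 ≤ p.1}.indicator (fun p : ℝ × ℝ => g p.1 * φ p.2) (s, u) := hswap
    _ = ∫ u in Ioc (0 : ℝ) 1, φ u * ∫ s in u..1, g s := setIntegral_congr_fun measurableSet_Ioc hR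

/-- **The forward identity from the mild identity, real form.** If `G` is bounded measurable,
`F` is integrable on `[0, 1]`, `λ ≥ 0` and `F(T) = e^{-λT} c + ∫_{(0,T]} e^{-λ(T-s)} G(s) ds` for
`T ∈ [0, 1]`, then `∫₀¹ (G - λF) = F(1) - c` (Fubini on the triangle and two exponential integrals).
[folklore] -/
theorem integral_sub_mul_eq_of_mild {F G : ℝ → ℝ} {lam c B : ℝ} (hGm : Measurable G)
    (hGb : ∀ s, ‖G s‖ ≤ B) (hFi : IntervalIntegrable F volume 0 1) (hlam : 0 ≤ lam)
    (hmild : ∀ T ∈ Icc (0 : ℝ) 1, F T = Real.exp (-(lam * T)) * c +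
      ∫ s in Ioc 0 T, Real.exp (-(lam * (T - s))) * G s) :
    ∫ s in (0 : ℝ)..1, (G s - lam * F s) = F 1 - c := by
  have hB : 0 ≤ B := (norm_nonneg _).trans (hGb 0)
  -- the conjugated source `φ(u) = e^{λu} G(u)`
  obtain ⟨φ, hφ⟩ : ∃ φ : ℝ → ℝ, φ = fun u => Real.exp (lam * u) * G u := ⟨_, rfl⟩
  have hφm : Measurable φ := by
    rw [hφ]
    exact (by fun_prop : Measurable fun u : ℝ => Real.exp (lam * u)).mul hGm
  have hφi : IntegrableOn φ (Ioc 0 1) := by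
    refine Integrable.of_bound hφm.aestronglyMeasurable (Real.exp lam * B)
      (ae_restrict_of_forall_mem measurableSet_Ioc fun u hu => ?_)
    rw [hφ]
    simp only
    rw [norm_mul, Real.norm_of_nonneg (Real.exp_pos _).le]
    refine mul_le_mul (Real.exp_le_exp.2 ?_) (hGb u) (norm_nonneg _) (Real.exp_pos _).le
    exact mul_le_of_le_one_right hlam hu.2
  have hGi : IntervalIntegrable G volume 0 1 :=
    (intervalIntegrable_iff_integrableOn_Ioc_of_le zero_le_one).2
      (Integrable.of_bound hGm.aestronglyMeasurable B (Eventually.of_forall hGb))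
  -- `∫_{(0,T]} e^{-λ(T-s)} G(s) ds = e^{-λT} ∫_{(0,T]} φ`
  have hconv : ∀ T : ℝ, ∫ s in Ioc 0 T, Real.exp (-(lam * (T - s))) * G s =
      Real.exp (-(lam * T)) * ∫ s in Ioc 0 T, φ s := by
    intro T
    rw [← MeasureTheory.integral_const_mul]
    refine integral_congr_ae (Eventually.of_forall fun s => ?_)
    rw [hφ]
    simp only
    rw [show -(lam * (T - s)) = -(lam * T) + lam * s by ring, Real.exp_add, mul_assoc]
  -- the two exponential integrals
  have e1 : ∫ s in (0 : ℝ)..1, c * (lam * Real.exp (-(lam * s))) = c * (1 - Real.exp (-lam)) := by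
    rw [intervalIntegral.integral_const_mul, integral_mul_exp_neg_mul, mul_zero, neg_zero,
      Real.exp_zero, mul_one]
  have e2 : ∫ s in (0 : ℝ)..1, lam * (F s - Real.exp (-(lam * s)) * c) =
      (∫ u in Ioc (0 : ℝ) 1, G u) - Real.exp (-lam) * ∫ u in Ioc (0 : ℝ) 1, φ u := by
    rw [intervalIntegral.integral_of_le zero_le_one]
    have h1 : ∀ s ∈ Ioc (0 : ℝ) 1, lam * (F s - Real.exp (-(lam * s)) * c) =
        (lam * Real.exp (-(lam * s))) * ∫ u in Ioc 0 s, φ u := by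
      intro s hs
      rw [hmild s ⟨hs.1.le, hs.2⟩, hconv]
      ring
    rw [setIntegral_congr_fun measurableSet_Ioc h1,
      integral_Ioc_mul_integral_Ioc_swap hφi (by fun_prop)]
    have h2 : ∀ u ∈ Ioc (0 : ℝ) 1, φ u * ∫ s in u..1, lam * Real.exp (-(lam * s)) =
        G u - Real.exp (-lam) * φ u := by
      intro u _
      rw [integral_mul_exp_neg_mul, mul_one, hφ]
      simp only
      have hu1 : Real.exp (lam * u) * Real.exp (-(lam * u)) = 1 := by
        rw [← Real.exp_add, add_neg_cancel, Real.exp_zero]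
      linear_combination (G u) * hu1
    rw [setIntegral_congr_fun measurableSet_Ioc h2, MeasureTheory.integral_sub hGi.1 (hφi.const_mul _),
      MeasureTheory.integral_const_mul]
  -- integrability of the pieces
  have hEi : IntervalIntegrable (fun s : ℝ => Real.exp (-(lam * s)) * c) volume 0 1 :=
    (by fun_prop : Continuous fun s : ℝ => Real.exp (-(lam * s)) * c).intervalIntegrable 0 1
  have hBi : IntervalIntegrable (fun s : ℝ => lam * (F s - Real.exp (-(lam * s)) * c)) volume 0 1 :=
    (hFi.sub hEi).const_mul lam
  have hCi : IntervalIntegrable (fun s : ℝ => c * (lam * Real.exp (-(lam * s)))) volume 0 1 :=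
    (by fun_prop : Continuous fun s : ℝ => c * (lam * Real.exp (-(lam * s)))).intervalIntegrable 0 1
  have split : ∫ s in (0 : ℝ)..1, (G s - lam * F s) =
      (∫ s in (0 : ℝ)..1, G s) - (∫ s in (0 : ℝ)..1, lam * (F s - Real.exp (-(lam * s)) * c)) -
        ∫ s in (0 : ℝ)..1, c * (lam * Real.exp (-(lam * s))) := by
    rw [← intervalIntegral.integral_sub hGi hBi, ← intervalIntegral.integral_sub (hGi.sub hBi) hCi]
    refine intervalIntegral.integral_congr fun s _ => ?_
    ring
  have hF1 := hmild 1 ⟨zero_le_one, le_rfl⟩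
  rw [hconv, mul_one] at hF1
  rw [split, e1, e2, hF1, intervalIntegral.integral_of_le zero_le_one]
  ring

/-! ### The free heat operator on bounded measurable data -/

variable {N : ℕ}

/-- `∫⁻ ofReal (h(X + √2 b_t)) = ofReal (P_t h (X))` for bounded measurable `h ≥ 0` (the sample
`ω ↦ h(X + √2 b_t(ω))` is bounded measurable, hence integrable). [folklore] -/
theorem lintegral_ofReal_eq_ofReal_heatOp {h : Config N → ℝ} (hh : Measurable h) {B : ℝ}
    (hB : ∀ Y, ‖h Y‖ ≤ B) (h0 : ∀ Y, 0 ≤ h Y) (X : Config N) (t : ℝ≥0) :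
    ∫⁻ ω, ENNReal.ofReal (h (X + displacement t ω)) ∂wienerPaths N = ENNReal.ofReal (heatOp t h X) :=
  (ofReal_integral_eq_lintegral_ofReal
    (Integrable.of_bound (hh.comp (measurable_add_displacement X t)).aestronglyMeasurable B
      (Eventually.of_forall fun _ => hB _))
    (Eventually.of_forall fun _ => h0 _)).symm

/-- **`s ↦ heatOpR s h X` is measurable** for measurable real `h` (joint measurability of the
world-lines in sample and time, and Fubini measurability of the Bochner integral). [folklore] -/
theorem measurable_heatOpR {h : Config N → ℝ} (hh : Measurable h) (X : Config N) :
    Measurable fun s : ℝ => heatOpR s h X := by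
  have hwl : Measurable fun p : ℝ × PathSpace N => worldLine X p.2 p.1.toNNReal :=
    measurable_worldLine_prod.comp ((measurable_const.prodMk measurable_snd).prodMk measurable_fst)
  have hm : StronglyMeasurable fun p : ℝ × PathSpace N => h (worldLine X p.2 p.1.toNNReal) :=
    (hh.comp hwl).stronglyMeasurable
  have key : StronglyMeasurable fun s : ℝ => ∫ ω, h (worldLine X ω s.toNNReal) ∂wienerPaths N :=
    hm.integral_prod_right'
  simpa only [heatOpR, heatOp, worldLine_eq_add_displacement] using key.measurable

/-- `[0, ∞]`-arithmetic of the integrand: `a · ofReal (e x) = ofReal e · ofReal (a.toReal x)` for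
finite `a` and `e ≥ 0`. [folklore] -/
theorem ennreal_mul_ofReal_mul {a : ℝ≥0∞} (ha : a ≠ ⊤) {e : ℝ} (he : 0 ≤ e) (x : ℝ) :
    a * ENNReal.ofReal (e * x) = ENNReal.ofReal e * ENNReal.ofReal (a.toReal * x) := by
  obtain ⟨r, hr, rfl⟩ : ∃ r : ℝ, 0 ≤ r ∧ a = ENNReal.ofReal r :=
    ⟨a.toReal, ENNReal.toReal_nonneg, (ENNReal.ofReal_toReal ha).symm⟩
  rw [ENNReal.toReal_ofReal hr, ← ENNReal.ofReal_mul hr, ← ENNReal.ofReal_mul he]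
  congr 1
  ring

/-! ### The mild identity in real form -/

/-- **The mild identity tested on the ground state, in real form.** For bounded `v^per ≤ C`, a
bounded measurable `Ψ₀ ≥ 0` with the eigen-relation `e^{-tH}Ψ₀ = e^{-λt}Ψ₀` (`λ ≥ 0`) and the mild
Duhamel identity of the Feynman–Kac functional on `g = Ψ₀`: for `T ≥ 0`,
`P_TΨ₀(X) = e^{-λT}Ψ₀(X) + ∫_{(0,T]} e^{-λ(T-s)} P_s(WΨ₀)(X) ds`, `W = (∑ v^per).toReal`. [folklore] -/
theorem heatOpR_eq_of_mild {v : ℝ → ℝ≥0∞} {L : ℝ} {C : ℝ≥0} (hv : Measurable v)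
    (hC : ∀ x, periodizedPotential v L x ≤ C) {Ψ₀ : Config N → ℝ} (hΨm : Measurable Ψ₀)
    (hΨ0 : ∀ Y, 0 ≤ Ψ₀ Y) {M : ℝ} (hM : ∀ Y, ‖Ψ₀ Y‖ ≤ M) {lam : ℝ} (hlam : 0 ≤ lam)
    (heig : ∀ T : ℝ, 0 ≤ T → ∀ X : Config N,
      periodicFKSemigroup v L T (fun Y => ENNReal.ofReal (Ψ₀ Y)) X =
        ENNReal.ofReal (Real.exp (-(lam * T)) * Ψ₀ X))
    (hmild : ∀ T : ℝ, 0 ≤ T → ∀ X : Config N,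
      ∫⁻ ω, ENNReal.ofReal (Ψ₀ (worldLine X ω T.toNNReal)) ∂wienerPaths N =
        periodicFKSemigroup v L T (fun Y => ENNReal.ofReal (Ψ₀ Y)) X +
          ∫⁻ s in Set.Ioc (0 : ℝ) T, ∫⁻ ω,
            periodicInteraction v L (worldLine X ω s.toNNReal) *
              periodicFKSemigroup v L (T - s) (fun Y => ENNReal.ofReal (Ψ₀ Y))
                (worldLine X ω s.toNNReal) ∂wienerPaths N)
    {T : ℝ} (hT : 0 ≤ T) (X : Config N) :
    heatOpR T Ψ₀ X = Real.exp (-(lam * T)) * Ψ₀ X +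
      ∫ s in Ioc 0 T, Real.exp (-(lam * (T - s))) *
        heatOpR s (fun Y => (periodicInteraction v L Y).toReal * Ψ₀ Y) X := by
  -- the bounded measurable nonnegative observable `WΨ₀`
  have hM0 : 0 ≤ M := (norm_nonneg _).trans (hM 0)
  have hK0 : 0 ≤ ((N * N : ℕ) : ℝ) * C := by positivity
  have hhm : Measurable fun Y : Config N => (periodicInteraction v L Y).toReal * Ψ₀ Y :=
    (measurable_periodicInteraction hv L).ennreal_toReal.mul hΨm
  have hh0 : ∀ Y : Config N, 0 ≤ (periodicInteraction v L Y).toReal * Ψ₀ Y := fun Y =>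
    mul_nonneg ENNReal.toReal_nonneg (hΨ0 Y)
  have hhb : ∀ Y : Config N, ‖(periodicInteraction v L Y).toReal * Ψ₀ Y‖ ≤ ((N * N : ℕ) : ℝ) * C * M :=
    fun Y => by
    rw [norm_mul, Real.norm_of_nonneg ENNReal.toReal_nonneg]
    exact mul_le_mul (toReal_periodicInteraction_le hC Y) (hM Y) (norm_nonneg _) hK0
  have hG0 : ∀ s : ℝ, 0 ≤ heatOpR s (fun Y => (periodicInteraction v L Y).toReal * Ψ₀ Y) X :=
    fun s => MeasureTheory.integral_nonneg fun ω => hh0 _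
  have hGb : ∀ s : ℝ, ‖heatOpR s (fun Y => (periodicInteraction v L Y).toReal * Ψ₀ Y) X‖ ≤
      ((N * N : ℕ) : ℝ) * C * M := fun s => norm_heatOp_le hhb _ X
  have hGm := measurable_heatOpR hhm X
  -- the mild identity at `T`, along `X + √2 b`
  have h := hmild T hT X
  simp only [worldLine_eq_add_displacement] at h
  -- the inner integral: eigen-relation and conversion to a Bochner integral
  have hinner : ∀ s ∈ Ioc (0 : ℝ) T,
      ∫⁻ ω, periodicInteraction v L (X + displacement s.toNNReal ω) *
          periodicFKSemigroup v L (T - s) (fun Y => ENNReal.ofReal (Ψ₀ Y))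
            (X + displacement s.toNNReal ω) ∂wienerPaths N =
        ENNReal.ofReal (Real.exp (-(lam * (T - s))) *
          heatOpR s (fun Y => (periodicInteraction v L Y).toReal * Ψ₀ Y) X) := by
    intro s hs
    have hTs : 0 ≤ T - s := sub_nonneg.2 hs.2
    have hpt : ∀ ω : PathSpace N, periodicInteraction v L (X + displacement s.toNNReal ω) *
        periodicFKSemigroup v L (T - s) (fun Y => ENNReal.ofReal (Ψ₀ Y))
          (X + displacement s.toNNReal ω) =
        ENNReal.ofReal (Real.exp (-(lam * (T - s)))) *
          ENNReal.ofReal ((periodicInteraction v L (X + displacement s.toNNReal ω)).toReal *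
            Ψ₀ (X + displacement s.toNNReal ω)) := fun ω => by
      rw [heig (T - s) hTs]
      exact ennreal_mul_ofReal_mul (periodicInteraction_ne_top hC _) (Real.exp_pos _).le _
    rw [lintegral_congr hpt, lintegral_const_mul' _ _ ENNReal.ofReal_ne_top,
      lintegral_ofReal_eq_ofReal_heatOp hhm hhb hh0 X s.toNNReal,
      ← ENNReal.ofReal_mul (Real.exp_pos _).le]
    rfl
  -- the outer integral: conversion to a Bochner integral on `(0, T]`
  have hI : Integrable (fun s : ℝ => Real.exp (-(lam * (T - s))) *
      heatOpR s (fun Y => (periodicInteraction v L Y).toReal * Ψ₀ Y) X)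
      (volume.restrict (Ioc (0 : ℝ) T)) := by
    refine Integrable.of_bound
      ((by fun_prop : Measurable fun s : ℝ => Real.exp (-(lam * (T - s)))).mul hGm).aestronglyMeasurable
      (((N * N : ℕ) : ℝ) * C * M) (ae_restrict_of_forall_mem measurableSet_Ioc fun s hs => ?_)
    rw [norm_mul, Real.norm_of_nonneg (Real.exp_pos _).le]
    calc Real.exp (-(lam * (T - s))) *
          ‖heatOpR s (fun Y => (periodicInteraction v L Y).toReal * Ψ₀ Y) X‖
        ≤ 1 * (((N * N : ℕ) : ℝ) * C * M) :=
          mul_le_mul (Real.exp_le_one_iff.2 (neg_nonpos.2 (mul_nonneg hlam (sub_nonneg.2 hs.2))))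
            (hGb s) (norm_nonneg _) zero_le_one
      _ = ((N * N : ℕ) : ℝ) * C * M := one_mul _
  have houter : ∫⁻ s in Ioc (0 : ℝ) T, ENNReal.ofReal (Real.exp (-(lam * (T - s))) *
        heatOpR s (fun Y => (periodicInteraction v L Y).toReal * Ψ₀ Y) X) =
      ENNReal.ofReal (∫ s in Ioc (0 : ℝ) T, Real.exp (-(lam * (T - s))) *
        heatOpR s (fun Y => (periodicInteraction v L Y).toReal * Ψ₀ Y) X) :=
    (ofReal_integral_eq_lintegral_ofReal hI (ae_restrict_of_forall_mem measurableSet_Ioc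
      fun s _ => mul_nonneg (Real.exp_pos _).le (hG0 s))).symm
  have hA : 0 ≤ Real.exp (-(lam * T)) * Ψ₀ X := mul_nonneg (Real.exp_pos _).le (hΨ0 X)
  have hB : 0 ≤ ∫ s in Ioc (0 : ℝ) T, Real.exp (-(lam * (T - s))) *
      heatOpR s (fun Y => (periodicInteraction v L Y).toReal * Ψ₀ Y) X :=
    setIntegral_nonneg measurableSet_Ioc fun s _ => mul_nonneg (Real.exp_pos _).le (hG0 s)
  have hF0 : 0 ≤ heatOpR T Ψ₀ X := MeasureTheory.integral_nonneg fun ω => hΨ0 _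
  rw [lintegral_ofReal_eq_ofReal_heatOp hΨm hM hΨ0 X T.toNNReal, heig T hT X,
    setLIntegral_congr_fun measurableSet_Ioc hinner, houter, ← ENNReal.ofReal_add hA hB] at h
  exact (ENNReal.ofReal_eq_ofReal_iff hF0 (add_nonneg hA hB)).1 h

end ForwardDuhamel

open ForwardDuhamel in
/-- **`stub_forwardDuhamelOfMild`** (line `third-law-current-floor`, S6r by the Markov route). The
MILD Duhamel identity of the periodic Feynman–Kac functional against the free flow (for measurable
`v` with bounded `v^per`, measurable `g ≥ 0`, `T ≥ 0`) implies, for the Feynman–Kac ground state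
`Ψ₀` of `H = -Δ + W` on the torus (`W = ∑_{i<j} v^per(xᵢ - xⱼ)` bounded measurable, `λ = E₀`), the
FORWARD Duhamel identity `duhamel 1 ((W - λ)Ψ₀) X = P_1Ψ₀(X) - Ψ₀(X)`: test the mild identity on
`g = Ψ₀`, use the eigen-relation in both Feynman–Kac terms, convert to reals
(`F(T) = e^{-λT}Ψ₀(X) + ∫₀ᵀ e^{-λ(T-s)}G(s) ds`, `F = P_·Ψ₀(X)`, `G = P_·(WΨ₀)(X)`), and one Fubini
on the triangle gives `∫₀¹(G - λF) = F(1) - Ψ₀(X)`; continuity and boundedness of `Ψ₀` from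
`PeriodicGroundStateFeynmanKac_holds` and uniqueness of the witness. [folklore] -/
theorem stub_forwardDuhamelOfMild :
    (∀ (N : ℕ) (L : ℝ) (v : ℝ → ℝ≥0∞), Measurable v →
      (∃ C : ℝ≥0, ∀ x, periodizedPotential v L x ≤ C) →
      ∀ g : Config N → ℝ≥0∞, Measurable g → ∀ T : ℝ, 0 ≤ T → ∀ X : Config N,
        ∫⁻ ω, g (worldLine X ω T.toNNReal) ∂wienerPaths N =
          periodicFKSemigroup v L T g X +
            ∫⁻ s in Set.Ioc (0 : ℝ) T, ∫⁻ ω,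
              periodicInteraction v L (worldLine X ω s.toNNReal) *
                periodicFKSemigroup v L (T - s) g (worldLine X ω s.toNNReal) ∂wienerPaths N) →
    ∀ (N : ℕ) (L : ℝ) (v : ℝ → ℝ≥0∞), 1 ≤ N → 0 < L → Measurable v →
      (∃ C : ℝ≥0, ∀ x, periodizedPotential v L x ≤ C) →
      ∀ Ψ₀ : Config N → ℝ, IsPeriodicGroundStateFK v L Ψ₀ → ∀ X : Config N,
        duhamel 1 (fun Y => ((periodicInteraction v L Y).toReal -
            (periodicGroundStateEnergy v N L).toReal) * Ψ₀ Y) X = heatOp 1 Ψ₀ X - Ψ₀ X := by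
  intro hmild N L v hN hL hv hCex Ψ₀ hGS X
  obtain ⟨C, hC⟩ := hCex
  -- `Ψ₀` is THE witness of the proved Feynman–Kac fact: continuous, hence bounded
  obtain ⟨Φ, hΦ, hcont, -⟩ := PeriodicGroundStateFeynmanKac_holds N L v hN hL hv ⟨C, hC⟩
  obtain rfl : Ψ₀ = Φ := hGS.unique hΦ
  obtain ⟨M, -, hM⟩ := exists_bound_of_continuous_periodic hL hcont hGS.periodic
  have hMn : ∀ Y, ‖Ψ₀ Y‖ ≤ M := fun Y => by rw [Real.norm_eq_abs]; exact hM Y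
  have hΨm : Measurable Ψ₀ := hGS.measurable
  have hΨ0 : ∀ Y, 0 ≤ Ψ₀ Y := hGS.nonneg
  have heig := hGS.eigen
  have hm := hmild N L v hv ⟨C, hC⟩ (fun Y => ENNReal.ofReal (Ψ₀ Y))
    (ENNReal.measurable_ofReal.comp hΨm)
  have hlam0 : 0 ≤ (periodicGroundStateEnergy v N L).toReal := ENNReal.toReal_nonneg
  generalize (periodicGroundStateEnergy v N L).toReal = lam at heig hlam0 ⊢
  -- the real interaction and the two flows `F = P_·Ψ₀(X)`, `G = P_·(WΨ₀)(X)`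
  have hK0 : 0 ≤ ((N * N : ℕ) : ℝ) * C := by positivity
  have hM0 : 0 ≤ M := (norm_nonneg _).trans (hMn 0)
  have hhm : Measurable fun Y : Config N => (periodicInteraction v L Y).toReal * Ψ₀ Y :=
    (measurable_periodicInteraction hv L).ennreal_toReal.mul hΨm
  have hhb : ∀ Y : Config N, ‖(periodicInteraction v L Y).toReal * Ψ₀ Y‖ ≤ ((N * N : ℕ) : ℝ) * C * M :=
    fun Y => by
    rw [norm_mul, Real.norm_of_nonneg ENNReal.toReal_nonneg]
    exact mul_le_mul (toReal_periodicInteraction_le hC Y) (hMn Y) (norm_nonneg _) hK0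
  have hGm := measurable_heatOpR hhm X
  have hGb : ∀ s : ℝ, ‖heatOpR s (fun Y => (periodicInteraction v L Y).toReal * Ψ₀ Y) X‖ ≤
      ((N * N : ℕ) : ℝ) * C * M := fun s => norm_heatOp_le hhb _ X
  have hFi : IntervalIntegrable (fun T : ℝ => heatOpR T Ψ₀ X) volume 0 1 :=
    (continuous_heatOpR hcont hMn X).intervalIntegrable 0 1
  -- the mild identity in real form, for `T ∈ [0, 1]`
  have hstar : ∀ T ∈ Icc (0 : ℝ) 1, heatOpR T Ψ₀ X = Real.exp (-(lam * T)) * Ψ₀ X +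
      ∫ s in Ioc 0 T, Real.exp (-(lam * (T - s))) *
        heatOpR s (fun Y => (periodicInteraction v L Y).toReal * Ψ₀ Y) X :=
    fun T hT => heatOpR_eq_of_mild hv hC hΨm hΨ0 hMn hlam0 heig hm hT.1 X
  -- linearity of the free flow: `P_s((W - λ)Ψ₀) = G(s) - λ F(s)`
  have hlin : ∀ s : ℝ, heatOpR s (fun Y => ((periodicInteraction v L Y).toReal - lam) * Ψ₀ Y) X =
      heatOpR s (fun Y => (periodicInteraction v L Y).toReal * Ψ₀ Y) X - lam * heatOpR s Ψ₀ X := by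
    intro s
    have i1 : Integrable (fun ω : PathSpace N =>
        (periodicInteraction v L (X + displacement s.toNNReal ω)).toReal *
          Ψ₀ (X + displacement s.toNNReal ω)) (wienerPaths N) :=
      Integrable.of_bound (hhm.comp (measurable_add_displacement X _)).aestronglyMeasurable
        (((N * N : ℕ) : ℝ) * C * M) (Eventually.of_forall fun ω => hhb _)
    have i2 : Integrable (fun ω : PathSpace N => Ψ₀ (X + displacement s.toNNReal ω))
        (wienerPaths N) :=
      Integrable.of_bound (hΨm.comp (measurable_add_displacement X _)).aestronglyMeasurable M
        (Eventually.of_forall fun ω => hMn _)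
    simp only [heatOpR, heatOp]
    rw [← MeasureTheory.integral_const_mul, ← MeasureTheory.integral_sub i1 (i2.const_mul lam)]
    refine integral_congr_ae (Eventually.of_forall fun ω => ?_)
    simp only
    ring
  simp only [duhamel, hlin]
  rw [integral_sub_mul_eq_of_mild (F := fun T => heatOpR T Ψ₀ X)
    (G := fun s => heatOpR s (fun Y => (periodicInteraction v L Y).toReal * Ψ₀ Y) X)
    hGm hGb hFi hlam0 hstar]
  simp only [heatOpR, Real.toNNReal_one]

end Summit.AtomisticToContinuum.BoseEinsteinCondensation.Cruxes.HardCoreExtension.ThirdLawCurrentFloor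

end
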